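import Mathlib
import Literature.Analysis.FluidPDE.VectorCalculus

/-!
# The tangency defect is AFFINE in the rotation rate with slope `−(rate column)`; the bordered defect of clause 13-R is the total
# derivative of `T` along the joint path `(X + s•Y, α + s•dα)` (crux `Clause13RNearStraightL`, stmt-NavierStokesRegularity-23612; line
# `rate_bordered_split`, stubs `stub_rateRow13RFlat` / `stub_clamped13JBordered`; also `SkeletonJ1R` stmt-23610, `RssProfileExists` stmt-16274)

Route `FilamentSkeletonRss`, Variant A1R.  The binders of the `SkeletonJ1*` / `Clause13*` family are
`hu : u Z y = Σ_k (Γγ_k/4π) • ∫ ((‖y − Z k σ‖² + κ·Aa k σ)^{3/2})⁻¹ • (Z_k′σ × (y − Z k σ)) dσ` (independent of `α`) and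
`hT : T Z j τ = W_α − (⟪W_α, Z_j′τ⟫/‖Z_j′τ‖²)•Z_j′τ`, `W_α = u Z (Z j τ) + ½ Z j τ − α e₃ × Z j τ`.
Clause 13-R measures a variation `Y` and a rate increment `dα` through the BORDERED DEFECT
`deriv (fun s => T (X + s•Y) j τ) 0 − dα • R_j(τ)`, `R_j(τ) = e₃ × X_jτ − ⟪e₃ × X_jτ, X_j′τ⟫ • X_j′τ` (the RATE COLUMN, as typed in the crux with
`‖X_j′τ‖ = 1`).  THIS FILE records, exactly and with no analytic side condition on the Biot–Savart binder:

* `tangencyDefect_alpha_affine` — for two rotation rates `α, α'` (binders `T`, `T'` over the SAME `u`):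
  **`T' Z j τ = T Z j τ − (α' − α) • R^Z_j(τ)`**, `R^Z_j(τ) := e₃ × Z_jτ − (⟪e₃ × Z_jτ, Z_j′τ⟫/‖Z_j′τ‖²) • Z_j′τ` — the tangency defect is AFFINE in
  `α` and its slope is minus the (projected) rate column: `∂T/∂α = −R_j`;
* `rateColumn_eq_of_unit` — at a unit-speed station the binder's projected column is the crux's `R_j` verbatim (`‖Z_j′τ‖ = 1`);
* `jointFamily_eq` — along the JOINT path `s ↦ (X + s•Y, α + s•dα)` (binder family `Tα s` at rate `α + s•dα`):
  `Tα s (X + s•Y) j τ = T (X + s•Y) j τ − (s•dα) • R^{X+s•Y}_j(τ)`;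
* `hasDerivAt_rateColumn_family` — `s ↦ R^{X+s•Y}_j(τ)` is differentiable at `s = 0` whenever `X_j, Y_j` are differentiable at `τ` and
  `X_j′τ ≠ 0` (it is a rational expression in `s`);
* `hasDerivAt_jointFamily` — **if `s ↦ T (X + s•Y) j τ` has derivative `D` at `0` (the landed closed form `…Clause13LinearisedMapClauses.
  hasDerivAt_linearisedMap_inBall` supplies it at in-ball stations), then the joint family has derivative `D − dα • R^X_j(τ)` at `0`**; with
  `‖X_j′τ‖ = 1` this is LITERALLY the bordered defect of 13-R (`deriv_jointFamily_eq_borderedDefect`).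

So the registered STUB R (`|dα|√Γ ≤ cnd·sup_ball ‖DT·Y − dα R_j‖`) is exactly the statement that the `α`-direction is quantitatively transverse
to the range of `D_X T` inside the total linearisation `D_{(X,α)}T(Y, dα)` of the profile map `(X, α) ↦ T_α(X)` on the clamped test class — the
form consumed by a joint (Lyapunov–Schmidt / bordered-operator) treatment, which is option (i) of the 23612 repair census of hand fsrs-8-g0
(evidence #25–#28 on 23612).  Complements `…Clause13RotationCovariance` (fsrs-3-g0: the rotation ORBIT has zero defect) and
`…Clause13TranslationCovariance` (this hand: translations are affine).

Hand `leafhand-ns-filamentskeletonrs-8-g1` (LAND-ONLY); `--supports stmt-NavierStokesRegularity-23612` helper.  HONEST FRAMING: calculus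
bookkeeping for a HYPOTHETICAL filament skeleton on the NEGATIVE side of a MODEL blow-up route; neither stub nor the crux is proved here, and nothing
in this file bears on Navier–Stokes regularity or blow-up.
-/

noncomputable section

open scoped InnerProductSpace BigOperators Topology
open MeasureTheory
open Literature.Analysis.FluidPDE

namespace Summit.NavierStokesRegularity.NavierStokesRegularity.Theorems.Clause13RateColumnAlphaSlope
set_option linter.dupNamespace false

/-! ## §1 `T` is affine in `α` with slope `−R_j` -/

/-- **`∂T/∂α = −(rate column)`, exactly**: for binders `T` (rate `α`) and `T'` (rate `α'`) over the same field binder `u`,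
`T' Z j τ = T Z j τ − (α' − α) • (e₃ × Z_jτ − (⟪e₃ × Z_jτ, Z_j′τ⟫/‖Z_j′τ‖²) • Z_j′τ)`. [folklore] -/
theorem tangencyDefect_alpha_affine {N : ℕ} {α α' : ℝ}
    {u : (Fin N → ℝ → EuclideanSpace ℝ (Fin 3)) → EuclideanSpace ℝ (Fin 3) → EuclideanSpace ℝ (Fin 3)}
    {T T' : (Fin N → ℝ → EuclideanSpace ℝ (Fin 3)) → Fin N → ℝ → EuclideanSpace ℝ (Fin 3)}
    (hT : ∀ Z j τ, T Z j τ = (u Z (Z j τ) + (1 / 2 : ℝ) • Z j τ - α • cross (EuclideanSpace.single 2 1) (Z j τ))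
      - (⟪u Z (Z j τ) + (1 / 2 : ℝ) • Z j τ - α • cross (EuclideanSpace.single 2 1) (Z j τ), deriv (Z j) τ⟫_ℝ
          / ‖deriv (Z j) τ‖ ^ 2) • deriv (Z j) τ)
    (hT' : ∀ Z j τ, T' Z j τ = (u Z (Z j τ) + (1 / 2 : ℝ) • Z j τ - α' • cross (EuclideanSpace.single 2 1) (Z j τ))
      - (⟪u Z (Z j τ) + (1 / 2 : ℝ) • Z j τ - α' • cross (EuclideanSpace.single 2 1) (Z j τ), deriv (Z j) τ⟫_ℝ
          / ‖deriv (Z j) τ‖ ^ 2) • deriv (Z j) τ)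
    (Z : Fin N → ℝ → EuclideanSpace ℝ (Fin 3)) (j : Fin N) (τ : ℝ) :
    T' Z j τ = T Z j τ - (α' - α) • (cross (EuclideanSpace.single 2 1) (Z j τ)
      - (⟪cross (EuclideanSpace.single 2 1) (Z j τ), deriv (Z j) τ⟫_ℝ / ‖deriv (Z j) τ‖ ^ 2) • deriv (Z j) τ) := by
  rw [hT, hT']
  set W := u Z (Z j τ) + (1 / 2 : ℝ) • Z j τ with hW
  set R := cross (EuclideanSpace.single 2 1) (Z j τ) with hR
  set t := deriv (Z j) τ with ht
  have h1 : W - α' • R = (W - α • R) - (α' - α) • R := by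
    rw [sub_smul]; abel
  rw [h1, inner_sub_left, real_inner_smul_left]
  module

/-- At a unit-speed station the binder's projected column is the crux's rate column verbatim. [folklore] -/
theorem rateColumn_eq_of_unit (x t : EuclideanSpace ℝ (Fin 3)) (ht : ‖t‖ = 1) :
    cross (EuclideanSpace.single 2 1) x - (⟪cross (EuclideanSpace.single 2 1) x, t⟫_ℝ / ‖t‖ ^ 2) • t
      = cross (EuclideanSpace.single 2 1) x - ⟪cross (EuclideanSpace.single 2 1) x, t⟫_ℝ • t := by
  rw [ht, one_pow, div_one]

/-! ## §2 The joint path `(X + s•Y, α + s•dα)` -/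

/-- Along the joint path the binder family at rate `α + s•dα` differs from the fixed-rate binder by `(s•dα) • R^{X+s•Y}_j(τ)`. [folklore] -/
theorem jointFamily_eq {N : ℕ} {α dα : ℝ}
    {u : (Fin N → ℝ → EuclideanSpace ℝ (Fin 3)) → EuclideanSpace ℝ (Fin 3) → EuclideanSpace ℝ (Fin 3)}
    {T : (Fin N → ℝ → EuclideanSpace ℝ (Fin 3)) → Fin N → ℝ → EuclideanSpace ℝ (Fin 3)}
    {Tα : ℝ → (Fin N → ℝ → EuclideanSpace ℝ (Fin 3)) → Fin N → ℝ → EuclideanSpace ℝ (Fin 3)}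
    (hT : ∀ Z j τ, T Z j τ = (u Z (Z j τ) + (1 / 2 : ℝ) • Z j τ - α • cross (EuclideanSpace.single 2 1) (Z j τ))
      - (⟪u Z (Z j τ) + (1 / 2 : ℝ) • Z j τ - α • cross (EuclideanSpace.single 2 1) (Z j τ), deriv (Z j) τ⟫_ℝ
          / ‖deriv (Z j) τ‖ ^ 2) • deriv (Z j) τ)
    (hTα : ∀ s Z j τ, Tα s Z j τ = (u Z (Z j τ) + (1 / 2 : ℝ) • Z j τ - (α + s * dα) • cross (EuclideanSpace.single 2 1) (Z j τ))
      - (⟪u Z (Z j τ) + (1 / 2 : ℝ) • Z j τ - (α + s * dα) • cross (EuclideanSpace.single 2 1) (Z j τ), deriv (Z j) τ⟫_ℝ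
          / ‖deriv (Z j) τ‖ ^ 2) • deriv (Z j) τ)
    (X Y : Fin N → ℝ → EuclideanSpace ℝ (Fin 3)) (j : Fin N) (τ s : ℝ) :
    Tα s (fun k σ => X k σ + s • Y k σ) j τ = T (fun k σ => X k σ + s • Y k σ) j τ
      - (s * dα) • (cross (EuclideanSpace.single 2 1) (X j τ + s • Y j τ)
        - (⟪cross (EuclideanSpace.single 2 1) (X j τ + s • Y j τ), deriv (fun σ => X j σ + s • Y j σ) τ⟫_ℝ
            / ‖deriv (fun σ => X j σ + s • Y j σ) τ‖ ^ 2) • deriv (fun σ => X j σ + s • Y j σ) τ) := by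
  have h := tangencyDefect_alpha_affine (α := α) (α' := α + s * dα) hT (hTα s) (fun k σ => X k σ + s • Y k σ) j τ
  rw [h, add_sub_cancel_left]

/-- The displaced tangent `deriv (X_j + s•Y_j) τ = X_j′τ + s•Y_j′τ` (both differentiable at `τ`). [folklore] -/
theorem deriv_displaced {X Y : ℝ → EuclideanSpace ℝ (Fin 3)} {τ : ℝ} (hX : DifferentiableAt ℝ X τ) (hY : DifferentiableAt ℝ Y τ)
    (s : ℝ) : deriv (fun σ => X σ + s • Y σ) τ = deriv X τ + s • deriv Y τ := by
  have h : HasDerivAt (fun σ => X σ + s • Y σ) (deriv X τ + s • deriv Y τ) τ :=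
    hX.hasDerivAt.add (hY.hasDerivAt.const_smul s)
  exact h.deriv

/-- The rate-column family `s ↦ R^{X+s•Y}_j(τ)` written with the displaced tangent `X_j′τ + s•Y_j′τ` is differentiable at every `s` with
`X_j′τ + s•Y_j′τ ≠ 0` (a rational expression in `s`). [folklore] -/
theorem differentiableAt_rateColumn_expr (x y t t' : EuclideanSpace ℝ (Fin 3)) {s : ℝ} (hs : t + s • t' ≠ 0) :
    DifferentiableAt ℝ (fun r : ℝ => cross (EuclideanSpace.single 2 1) (x + r • y)
      - (⟪cross (EuclideanSpace.single 2 1) (x + r • y), t + r • t'⟫_ℝ / ‖t + r • t'‖ ^ 2) • (t + r • t')) s := by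
  have hlin : DifferentiableAt ℝ (fun r : ℝ => x + r • y) s := (differentiableAt_id.smul_const y).const_add x
  have htan : DifferentiableAt ℝ (fun r : ℝ => t + r • t') s := (differentiableAt_id.smul_const t').const_add t
  have hcross : DifferentiableAt ℝ (fun r : ℝ => cross (EuclideanSpace.single 2 1) (x + r • y)) s := by
    have h := ((crossCLM (EuclideanSpace.single 2 1 : EuclideanSpace ℝ (Fin 3))).differentiableAt).comp s hlin
    simpa [Function.comp_def] using h
  have hinner : DifferentiableAt ℝ (fun r : ℝ => ⟪cross (EuclideanSpace.single 2 1) (x + r • y), t + r • t'⟫_ℝ) s :=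
    hcross.inner ℝ htan
  have hnorm : DifferentiableAt ℝ (fun r : ℝ => ‖t + r • t'‖ ^ 2) s := htan.norm_sq ℝ
  have hne : ‖t + s • t'‖ ^ 2 ≠ 0 := pow_ne_zero 2 (norm_ne_zero_iff.2 hs)
  exact hcross.sub ((hinner.div hnorm hne).smul htan)

/-- **Derivative of the joint family.**  If the fixed-rate displaced family `s ↦ T (X + s•Y) j τ` has derivative `D` at `s = 0`, `X_j, Y_j` are
differentiable at `τ` and `X_j′τ ≠ 0`, then the JOINT family `s ↦ Tα s (X + s•Y) j τ` (rate `α + s•dα`) has derivative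
`D − dα • R^X_j(τ)` at `s = 0`. [folklore] -/
theorem hasDerivAt_jointFamily {N : ℕ} {α dα : ℝ}
    {u : (Fin N → ℝ → EuclideanSpace ℝ (Fin 3)) → EuclideanSpace ℝ (Fin 3) → EuclideanSpace ℝ (Fin 3)}
    {T : (Fin N → ℝ → EuclideanSpace ℝ (Fin 3)) → Fin N → ℝ → EuclideanSpace ℝ (Fin 3)}
    {Tα : ℝ → (Fin N → ℝ → EuclideanSpace ℝ (Fin 3)) → Fin N → ℝ → EuclideanSpace ℝ (Fin 3)}
    (hT : ∀ Z j τ, T Z j τ = (u Z (Z j τ) + (1 / 2 : ℝ) • Z j τ - α • cross (EuclideanSpace.single 2 1) (Z j τ))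
      - (⟪u Z (Z j τ) + (1 / 2 : ℝ) • Z j τ - α • cross (EuclideanSpace.single 2 1) (Z j τ), deriv (Z j) τ⟫_ℝ
          / ‖deriv (Z j) τ‖ ^ 2) • deriv (Z j) τ)
    (hTα : ∀ s Z j τ, Tα s Z j τ = (u Z (Z j τ) + (1 / 2 : ℝ) • Z j τ - (α + s * dα) • cross (EuclideanSpace.single 2 1) (Z j τ))
      - (⟪u Z (Z j τ) + (1 / 2 : ℝ) • Z j τ - (α + s * dα) • cross (EuclideanSpace.single 2 1) (Z j τ), deriv (Z j) τ⟫_ℝ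
          / ‖deriv (Z j) τ‖ ^ 2) • deriv (Z j) τ)
    {X Y : Fin N → ℝ → EuclideanSpace ℝ (Fin 3)} {j : Fin N} {τ : ℝ}
    (hX : DifferentiableAt ℝ (X j) τ) (hY : DifferentiableAt ℝ (Y j) τ) (ht : deriv (X j) τ ≠ 0)
    {D : EuclideanSpace ℝ (Fin 3)} (hD : HasDerivAt (fun s : ℝ => T (fun k σ => X k σ + s • Y k σ) j τ) D 0) :
    HasDerivAt (fun s : ℝ => Tα s (fun k σ => X k σ + s • Y k σ) j τ)
      (D - dα • (cross (EuclideanSpace.single 2 1) (X j τ)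
        - (⟪cross (EuclideanSpace.single 2 1) (X j τ), deriv (X j) τ⟫_ℝ / ‖deriv (X j) τ‖ ^ 2) • deriv (X j) τ)) 0 := by
  -- the rate-column family, written with the displaced tangent
  set g : ℝ → EuclideanSpace ℝ (Fin 3) := fun r => cross (EuclideanSpace.single 2 1) (X j τ + r • Y j τ)
      - (⟪cross (EuclideanSpace.single 2 1) (X j τ + r • Y j τ), deriv (X j) τ + r • deriv (Y j) τ⟫_ℝ
          / ‖deriv (X j) τ + r • deriv (Y j) τ‖ ^ 2) • (deriv (X j) τ + r • deriv (Y j) τ) with hg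
  have hfam : (fun s : ℝ => Tα s (fun k σ => X k σ + s • Y k σ) j τ)
      = fun s : ℝ => T (fun k σ => X k σ + s • Y k σ) j τ - (s * dα) • g s := by
    funext s
    rw [jointFamily_eq hT hTα X Y j τ s, hg]
    simp only [deriv_displaced hX hY s]
  rw [hfam]
  have hg0 : g 0 = cross (EuclideanSpace.single 2 1) (X j τ)
      - (⟪cross (EuclideanSpace.single 2 1) (X j τ), deriv (X j) τ⟫_ℝ / ‖deriv (X j) τ‖ ^ 2) • deriv (X j) τ := by
    simp [hg]
  have hgd : DifferentiableAt ℝ g 0 := by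
    have h := differentiableAt_rateColumn_expr (X j τ) (Y j τ) (deriv (X j) τ) (deriv (Y j) τ) (s := 0) (by simpa using ht)
    simpa [hg] using h
  have hsc : HasDerivAt (fun s : ℝ => s * dα) dα 0 := by simpa using (hasDerivAt_id (0:ℝ)).mul_const dα
  have hprod := hsc.smul hgd.hasDerivAt
  have h := hD.sub hprod
  simp only [zero_mul, zero_smul, zero_add] at h
  rw [hg0] at h
  have e : (fun s : ℝ => T (fun k σ => X k σ + s • Y k σ) j τ - (s * dα) • g s)
      = ((fun s : ℝ => T (fun k σ => X k σ + s • Y k σ) j τ) - (fun s : ℝ => s * dα) • g) := rfl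
  rw [e]
  exact h

/-- **The bordered defect of 13-R is the joint derivative**: under the hypotheses of `hasDerivAt_jointFamily` and at a UNIT-SPEED station,
`deriv (fun s => Tα s (X + s•Y) j τ) 0 = deriv (fun s => T (X + s•Y) j τ) 0 − dα • (e₃ × X_jτ − ⟪e₃ × X_jτ, X_j′τ⟫ • X_j′τ)`,
the right-hand side being the 13-R text's `DT·Y − dα·R_j` verbatim. [folklore] -/
theorem deriv_jointFamily_eq_borderedDefect {N : ℕ} {α dα : ℝ}
    {u : (Fin N → ℝ → EuclideanSpace ℝ (Fin 3)) → EuclideanSpace ℝ (Fin 3) → EuclideanSpace ℝ (Fin 3)}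
    {T : (Fin N → ℝ → EuclideanSpace ℝ (Fin 3)) → Fin N → ℝ → EuclideanSpace ℝ (Fin 3)}
    {Tα : ℝ → (Fin N → ℝ → EuclideanSpace ℝ (Fin 3)) → Fin N → ℝ → EuclideanSpace ℝ (Fin 3)}
    (hT : ∀ Z j τ, T Z j τ = (u Z (Z j τ) + (1 / 2 : ℝ) • Z j τ - α • cross (EuclideanSpace.single 2 1) (Z j τ))
      - (⟪u Z (Z j τ) + (1 / 2 : ℝ) • Z j τ - α • cross (EuclideanSpace.single 2 1) (Z j τ), deriv (Z j) τ⟫_ℝ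
          / ‖deriv (Z j) τ‖ ^ 2) • deriv (Z j) τ)
    (hTα : ∀ s Z j τ, Tα s Z j τ = (u Z (Z j τ) + (1 / 2 : ℝ) • Z j τ - (α + s * dα) • cross (EuclideanSpace.single 2 1) (Z j τ))
      - (⟪u Z (Z j τ) + (1 / 2 : ℝ) • Z j τ - (α + s * dα) • cross (EuclideanSpace.single 2 1) (Z j τ), deriv (Z j) τ⟫_ℝ
          / ‖deriv (Z j) τ‖ ^ 2) • deriv (Z j) τ)
    {X Y : Fin N → ℝ → EuclideanSpace ℝ (Fin 3)} {j : Fin N} {τ : ℝ}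
    (hX : DifferentiableAt ℝ (X j) τ) (hY : DifferentiableAt ℝ (Y j) τ) (hunit : ‖deriv (X j) τ‖ = 1)
    (hdiff : DifferentiableAt ℝ (fun s : ℝ => T (fun k σ => X k σ + s • Y k σ) j τ) 0) :
    deriv (fun s : ℝ => Tα s (fun k σ => X k σ + s • Y k σ) j τ) 0
      = deriv (fun s : ℝ => T (fun k σ => X k σ + s • Y k σ) j τ) 0
        - dα • (cross (EuclideanSpace.single 2 1) (X j τ)
          - ⟪cross (EuclideanSpace.single 2 1) (X j τ), deriv (X j) τ⟫_ℝ • deriv (X j) τ) := by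
  have ht : deriv (X j) τ ≠ 0 := by
    intro h; rw [h, norm_zero] at hunit; exact zero_ne_one hunit
  rw [(hasDerivAt_jointFamily hT hTα hX hY ht hdiff.hasDerivAt).deriv, rateColumn_eq_of_unit _ _ hunit]

/-- **Junk-robust form at a unit-speed station.**  Without any differentiability hypothesis on the displaced family: if `s ↦ T (X + s•Y) j τ` is NOT
differentiable at `0` then neither is the joint family (they differ by the differentiable term `(s•dα) • R^{X+s•Y}_j(τ)`), so BOTH `deriv`s are the
junk value `0` and the bordered defect of the text reduces to `−dα • R_j(τ)` — the `Y ≡ 0` instance already covered by the rate-column floor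
(`…Clause13RRateColumnBall`).  Recorded as the dichotomy used by clause-level proofs. [folklore] -/
theorem jointFamily_differentiableAt_iff {N : ℕ} {α dα : ℝ}
    {u : (Fin N → ℝ → EuclideanSpace ℝ (Fin 3)) → EuclideanSpace ℝ (Fin 3) → EuclideanSpace ℝ (Fin 3)}
    {T : (Fin N → ℝ → EuclideanSpace ℝ (Fin 3)) → Fin N → ℝ → EuclideanSpace ℝ (Fin 3)}
    {Tα : ℝ → (Fin N → ℝ → EuclideanSpace ℝ (Fin 3)) → Fin N → ℝ → EuclideanSpace ℝ (Fin 3)}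
    (hT : ∀ Z j τ, T Z j τ = (u Z (Z j τ) + (1 / 2 : ℝ) • Z j τ - α • cross (EuclideanSpace.single 2 1) (Z j τ))
      - (⟪u Z (Z j τ) + (1 / 2 : ℝ) • Z j τ - α • cross (EuclideanSpace.single 2 1) (Z j τ), deriv (Z j) τ⟫_ℝ
          / ‖deriv (Z j) τ‖ ^ 2) • deriv (Z j) τ)
    (hTα : ∀ s Z j τ, Tα s Z j τ = (u Z (Z j τ) + (1 / 2 : ℝ) • Z j τ - (α + s * dα) • cross (EuclideanSpace.single 2 1) (Z j τ))
      - (⟪u Z (Z j τ) + (1 / 2 : ℝ) • Z j τ - (α + s * dα) • cross (EuclideanSpace.single 2 1) (Z j τ), deriv (Z j) τ⟫_ℝ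
          / ‖deriv (Z j) τ‖ ^ 2) • deriv (Z j) τ)
    {X Y : Fin N → ℝ → EuclideanSpace ℝ (Fin 3)} {j : Fin N} {τ : ℝ}
    (hX : DifferentiableAt ℝ (X j) τ) (hY : DifferentiableAt ℝ (Y j) τ) (ht : deriv (X j) τ ≠ 0) :
    DifferentiableAt ℝ (fun s : ℝ => Tα s (fun k σ => X k σ + s • Y k σ) j τ) 0
      ↔ DifferentiableAt ℝ (fun s : ℝ => T (fun k σ => X k σ + s • Y k σ) j τ) 0 := by
  set g : ℝ → EuclideanSpace ℝ (Fin 3) := fun r => cross (EuclideanSpace.single 2 1) (X j τ + r • Y j τ)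
      - (⟪cross (EuclideanSpace.single 2 1) (X j τ + r • Y j τ), deriv (X j) τ + r • deriv (Y j) τ⟫_ℝ
          / ‖deriv (X j) τ + r • deriv (Y j) τ‖ ^ 2) • (deriv (X j) τ + r • deriv (Y j) τ) with hg
  have hfam : (fun s : ℝ => Tα s (fun k σ => X k σ + s • Y k σ) j τ)
      = fun s : ℝ => T (fun k σ => X k σ + s • Y k σ) j τ - (s * dα) • g s := by
    funext s
    rw [jointFamily_eq hT hTα X Y j τ s, hg]
    simp only [deriv_displaced hX hY s]
  have hgd : DifferentiableAt ℝ g 0 := by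
    have h := differentiableAt_rateColumn_expr (X j τ) (Y j τ) (deriv (X j) τ) (deriv (Y j) τ) (s := 0) (by simpa using ht)
    simpa [hg] using h
  have hcorr : DifferentiableAt ℝ (fun s : ℝ => (s * dα) • g s) 0 :=
    (differentiableAt_id.mul_const dα).smul hgd
  rw [hfam]
  constructor
  · intro h
    have e : (fun s : ℝ => T (fun k σ => X k σ + s • Y k σ) j τ)
        = fun s : ℝ => (T (fun k σ => X k σ + s • Y k σ) j τ - (s * dα) • g s) + (s * dα) • g s := by
      funext s; rw [sub_add_cancel]
    rw [e]
    exact h.add hcorr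
  · intro h
    exact h.sub hcorr

end Summit.NavierStokesRegularity.NavierStokesRegularity.Theorems.Clause13RateColumnAlphaSlope

end
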